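import Summits.PneNP.PneNP.Theorems.NegLimitedHalfWindowTribesBiasBlocks
import Mathlib
import HarnessLib

/-!
# Route NegLimited — line `half-window`, stub `stub_tribesRM3Count` (C): the number of ones of `TRIBES ∘ RM3`
(rung F-N1/p3, ROUND-13; item stmt-PneNP-19888 `NegLimited.NeglimitedHalfLogNegationsR`, registered skeleton
`half-window`; card HOME/pnp-ideate-p3/r13/half-window.md)

`stub_tribesRM3Count : TribesRM3Count` — for all `w m d`,

  `#{y : (Fin m × Fin w) × (Fin d → Fin 3) → Bool | TRIBES_{w,m}(RM3_d(y)) = 1} = 2^{m·w·3^d}·(1 − (1 − 2^{-w})^m)`.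

PROOF: the read-once composition formula `rgbias_tribesRM3` (TB part 1, p490514) at the ALL-FREE restriction: the
recursively computed bias of an unrestricted `RM3_d` is `0` (`rbias_allFree` — self-duality in the form `E sgn = 0`),
so `P₀ = (1 − 2^{-w})^m` and `Σ_y sgn(TRIBES∘RM3 (y)) = 2^N·(1 − 2(1−2^{-w})^m)`, `N = m·w·3^d`; the count is
`Σ_y (1 + sgn)/2`.  (Formula checked by p3 with `native_decide` on `(w,m,d) ∈ {(2,1,1),(1,2,1),(2,2,0)}`.)

HONEST FRAMING: ONE registered (S-sized) stub of an OPEN rung item; FRONTIER rung F-N1 — nothing here bears on P vs NP.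
-/

set_option linter.dupNamespace false -- `Summit.PneNP.PneNP.…`: summit = sub-problem name (D-0017 single-conjunct layout)

namespace Summit.PneNP.PneNP.Theorems.NegLimitedHalfWindow

open Finset
open Summit.PneNP.PneNP.Theorems.NegLimitedAmplifiedWindow (Restr rbias)
open Summit.PneNP.PneNP.Theorems.NegLimitedAmplifiedWindow.Amp (sgn)

/-- The recursively computed bias of the UNRESTRICTED `RM3_d` is `0`. -/
theorem rbias_allFree : ∀ d : ℕ, rbias d (fun _ => (none : Option Bool)) = 0
  | 0 => by simp [rbias]
  | d + 1 => by
    simp only [rbias]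
    rw [rbias_allFree d]
    ring

/-- At the all-free restriction `P₀ = (1 − 2^{-w})^m`. -/
theorem tribesP0_allFree (w m d : ℕ) :
    tribesP0 w m d (fun _ _ => (none : Option Bool)) = (1 - ((1 : ℝ) / 2) ^ w) ^ m := by
  unfold tribesP0
  simp only [rbias_allFree, add_zero, Finset.prod_const, Finset.card_univ, Fintype.card_fin]

/-- The number of input bits: `|(Fin m × Fin w) × (Fin d → Fin 3)| = m·w·3^d`. -/
theorem card_blocks (w m d : ℕ) : Fintype.card ((Fin m × Fin w) × (Fin d → Fin 3)) = m * w * 3 ^ d := by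
  simp

/-- The total sign of `TRIBES ∘ RM3` over all inputs: `Σ_y sgn = 2^{m w 3^d}·(1 − 2(1 − 2^{-w})^m)`. -/
theorem sum_sgn_tribesRM3 (w m d : ℕ) :
    ∑ y : (Fin m × Fin w) × (Fin d → Fin 3) → Bool, sgn (tribesRM3 w m d y) =
      (2 : ℝ) ^ (m * w * 3 ^ d) * (1 - 2 * (1 - ((1 : ℝ) / 2) ^ w) ^ m) := by
  have h := rgbias_tribesRM3 w m d (fun _ _ => (none : Option Bool))
  rw [tribesP0_allFree] at h
  unfold rgbias at h
  rw [card_blocks] at h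
  have hfree : ∀ z : (Fin m × Fin w) × (Fin d → Fin 3) → Bool,
      (fun q => (Function.uncurry (fun (_ : Fin m × Fin w) (_ : Fin d → Fin 3) => (none : Option Bool)) q).getD (z q))
        = z := fun z => by
    funext q
    rfl
  simp only [hfree] at h
  have h2 : (2 : ℝ) ^ (m * w * 3 ^ d) ≠ 0 := by positivity
  calc ∑ y : (Fin m × Fin w) × (Fin d → Fin 3) → Bool, sgn (tribesRM3 w m d y)
      = (2 : ℝ) ^ (m * w * 3 ^ d) * (((2 : ℝ) ^ (m * w * 3 ^ d))⁻¹ *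
          ∑ y : (Fin m × Fin w) × (Fin d → Fin 3) → Bool, sgn (tribesRM3 w m d y)) := by
        rw [← mul_assoc, mul_inv_cancel₀ h2, one_mul]
    _ = (2 : ℝ) ^ (m * w * 3 ^ d) * (1 - 2 * (1 - ((1 : ℝ) / 2) ^ w) ^ m) := by rw [h]

/-- **Registered stub `stub_tribesRM3Count`** of the skeleton `half-window` (stmt-PneNP-19888): the number of ones of
`TRIBES_{w,m} ∘ RM3_d` is `2^{m w 3^d}·(1 − (1 − 2^{-w})^m)`, BY NAME. -/
theorem stub_tribesRM3Count : TribesRM3Count := by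
  intro w m d
  have hcount : (((Finset.univ : Finset ((Fin m × Fin w) × (Fin d → Fin 3) → Bool)).filter
      fun y => tribesRM3 w m d y = true).card : ℝ) =
      ∑ y : (Fin m × Fin w) × (Fin d → Fin 3) → Bool, (if tribesRM3 w m d y then (1 : ℝ) else 0) := by
    rw [Finset.card_filter]
    push_cast
    rfl
  rw [hcount]
  simp_rw [ite_eq_sgn]
  rw [← Finset.sum_div, Finset.sum_add_distrib, Finset.sum_const, Finset.card_univ, nsmul_eq_mul, mul_one,
    sum_sgn_tribesRM3]
  have hcard : (Fintype.card ((Fin m × Fin w) × (Fin d → Fin 3) → Bool) : ℝ) = (2 : ℝ) ^ (m * w * 3 ^ d) := by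
    rw [Fintype.card_fun, Fintype.card_bool, card_blocks]
    push_cast
    rfl
  rw [hcard]
  ring

end Summit.PneNP.PneNP.Theorems.NegLimitedHalfWindow
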